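import Summits.HodgeConjecture.HodgeConjecture.Theorems.F0P2oThetaTypeJacquetWeightSpaceOfDictionary  -- ★ p834861: letter (a) from the dictionary
import Summits.HodgeConjecture.HodgeConjecture.Theorems.F0P2oK1occ                                    -- ★ `continuous_of_isThetaCenterChar`
import Literature.NumberTheory.Rogawski1990.XiLocalCharacter                                          -- ★ `continuous_localDet`
import HarnessLib

/-!
# Crux `H413`, programme P2, N3 road (a) — LETTER (a) FROM THE (S5) DICTIONARY, SIDE CONDITIONS DISCHARGED
# (the continuity of `ψθ ∘ det ∘ localPiEquiv` follows from `Continuous χ_f` and ★ `IsThetaCenterChar`)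

Cell hodgecm-mathlib (D-0151), FLOOR 0, crux item H413 = stmt-HodgeConjecture-24833, programme P2; N3 road (a), seat A-p12 (g17).  A one-theorem
complement to ★ p834861 `F0P2oThetaTypeJacquetWeightSpaceOfDictionary.nonempty_jacquet_xThetaGqsCM_equiv_weightSpace_of_thetaCenterChar`: its
continuity hypothesis `hψc` on `u ↦ ψθ(det u)` is DISCHARGED from the letter's own hypotheses `Continuous χ_f` and ★ `IsThetaCenterChar L μ χf ε v ψθ`
(★ `F0P2oK1occ.continuous_of_isThetaCenterChar`: `ψθ` is continuous on `E¹_v`; ★ `continuous_localDet`; `localPiEquiv` is a homeomorphism), so that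
**letter (a) of ★ `GelbartRogawski1991.thetaType_nonsplit_jacquetModule` now follows from EXACTLY ONE DATUM, the (S5) dictionary chart**
`(π, hπ, hker, σ, hσ, Tr, hTr)`: a Jacquet chart of `ω_v ∘ localLineInl ∘ localPiEquiv⁻¹ ∘ cmDatumLocalCongr T` along `(cmBorelTriple L 3 v).N` onto
`𝒮(Fin n₀ → L⁺_v)` on which the centre `u·1₃` of `U(V)(L⁺_v)` acts as `μ_v(det u) · ω¹(γ_v, ψ_v)(u)` (N3 road note v2 §1 (S5), §2 (D1)–(D3)).
Under the letter's binders (`Continuous χf`, `hv`, `IsThetaCenterChar`, `(T, a, ha, h)`) the theorem below has no other hypothesis.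
[GelbartRogawski1991 §3.2 (3.2.1)–(3.2.3) p. 457, §5.1 (5.1.1) p. 465, §5.2 p. 467; Kudla1986 Thm. 2.8; MoeglinVignerasWaldspurger1987 Chap. 3 §IV.4–5.]

## References
* [GelbartRogawski1991] S. Gelbart, J. Rogawski, *L-functions and Fourier–Jacobi coefficients for the unitary group U(3)*, Invent. Math. 105 (1991):
  §3.2 (3.2.1)–(3.2.3) p. 457; §5.1 (5.1.1) p. 465; §5.2 p. 467 L25–27.
* [Kudla1986] S. Kudla, *On the local theta-correspondence*, Invent. Math. 83 (1986): Thm. 2.8.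
* [MoeglinVignerasWaldspurger1987] C. Mœglin, M.-F. Vignéras, J.-L. Waldspurger, *Correspondances de Howe sur un corps p-adique*, LNM 1291 (1987): Chap. 3 §IV.4, §IV.5.
-/

set_option autoImplicit false
set_option linter.dupNamespace false -- the mandated namespace repeats the single-problem summit's segment

noncomputable section

open NumberField IsDedekindDomain
open scoped Matrix Kronecker
open Literature.RepresentationTheory Literature.NumberTheory.Automorphic Representation
open Literature.NumberTheory Literature.NumberTheory.Automorphic.UnitaryGroup
open Literature.NumberTheory.Automorphic.IdeleClassGroup
open Literature.NumberTheory.Automorphic.Liu2021 Literature.NumberTheory.Automorphic.Liu2021.Def411WeilCarriers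
open Literature.NumberTheory.GelbartRogawski1991 Literature.NumberTheory.GelbartRogawski1991.UnitaryDualPair
open Literature.NumberTheory.GelbartRogawski1991.UnitaryDualPair.WeilCoinv Literature.NumberTheory.GelbartRogawski1991.UnitaryDualPair.LocalSplitting
open Literature.NumberTheory.GaloisRepresentations Literature.NumberTheory.Rogawski1990
open Literature.RepresentationTheory.Liu2021 Literature.RepresentationTheory.HeisenbergGroup
open Summit.HodgeConjecture.HodgeConjecture.Cruxes.H413.F0P2oThetaTypeJacquetWeightSpaceOfDictionary
open Summit.HodgeConjecture.HodgeConjecture.Cruxes.H413.F0P2oK1occ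

namespace Summit.HodgeConjecture.HodgeConjecture.Cruxes.H413.F0P2oThetaTypeJacquetLetterAOfDictionary

variable (L : Type) [Field L] [NumberField L] [IsCMField L]

set_option synthInstance.maxHeartbeats 400000 in
set_option maxHeartbeats 8000000 in
/-- **LETTER (a) OF ★ `thetaType_nonsplit_jacquetModule` FROM ONE (S5) DICTIONARY CHART, under the letter's own binders** (`Continuous χ_f`, `v` non-split,
★ `IsThetaCenterChar L μ χf ε v ψθ`, a form congruence `(T, a, h)`): if a Jacquet chart `(π, σ)` of `ω_v ∘ localLineInl ∘ localPiEquiv⁻¹ ∘ cmDatumLocalCongr T`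
along `N` is carried by `Tr : S₁ ≃ₗ[ℂ] 𝒮(Fin n₀ → L⁺_v)` to `μ_v(det ·)⁻¹ ⊗ ω¹(γ_v, ψ_v)`
(`hTr`: «`ω¹(u) (Tr s) = μ_v(det u)⁻¹ • Tr (σ u s)`», print's «`d(β, β, β)` acts on `ℱ_v` by `γ_v(β) ω¹(β)`»), then
`Nonempty (r_N(X_v) ≃ₗ[ℂ] ℱ_v[ψθ])` with both sides the letter's, token for token.
[cite: GelbartRogawski1991, §3.2 (3.2.1)–(3.2.3) p. 457; §5.1 (5.1.1) p. 465; proof of Prop. 5.2.1 p. 467 L25–27] [cite: Kudla1986, Thm. 2.8]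
[cite: MoeglinVignerasWaldspurger1987, Chap. 3 §IV.4, §IV.5] -/
theorem nonempty_jacquet_xThetaGqsCM_equiv_weightSpace_of_continuous {n' : ℕ} (e₁ : Fin 3 × Fin 1 ≃ Fin n') (dV : Fin 3 → L)
    (hdV : ∀ i, IsCMField.complexConj L (dV i) = dV i) (hdV0 : ∀ i, dV i ≠ 0) {n₀ : ℕ} (e₀ : Fin 1 × Fin 1 ≃ Fin n₀)
    (μ : Literature.NumberTheory.Automorphic.IdeleClassGroup L →ₜ* Circle) (hμ : IsConjugateSymplectic L μ)
    (χf : UnitaryGroup.finAdelicOne (↥(maximalRealSubfield L)) L (IsCMField.complexConj L) →* ℂˣ) (ε : (↥(maximalRealSubfield L))ˣ)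
    (v : HeightOneSpectrum (𝓞 ↥(maximalRealSubfield L))) (hv : ∀ w : PlacesOver L v, IsCMField.complexConj L • w.1 = w.1)
    (hχf : Continuous χf) (ψθ : ↥(normOneUnits (conjLocal L (IsCMField.complexConj L) v)) →* ℂˣ) (hψθ : IsThetaCenterChar L μ χf ε v ψθ)
    (T : GL (Fin 3) (UnitaryGroup.LocalRing L v)) {a : UnitaryGroup.LocalRing L v} (ha : IsUnit a)
    (h : formCongr (conjLocal L (IsCMField.complexConj L) v) T ((Matrix.diagonal dV).map (algebraMap L (UnitaryGroup.LocalRing L v))) =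
      a • (Matrix.of fun i j : Fin 3 => if i.val + j.val + 1 = 3 then (1 : L) else 0).map (algebraMap L (UnitaryGroup.LocalRing L v)))
    {S₁ : Type*} [AddCommGroup S₁] [Module ℂ S₁]
    (π : SchwartzBruhat (Fin n' → v.adicCompletion ↥(maximalRealSubfield L)) →ₗ[ℂ] S₁) (hπ : Function.Surjective π)
    (hker : LinearMap.ker π = Coinvariants.ker
      (((((chiLocalSplittingsCM L e₁ dV hdV hdV0 (toHeckeCharacter L μ) ((isOscillatorChar_toHeckeCharacter_iff μ).mpr hμ) ε).omegaLoc v).comp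
        (localLineInl L (IsCMField.complexConj L) 3 e₁ (Matrix.diagonal dV) (JW (↥(maximalRealSubfield L)) L ε) v)).comp
        ((localPiEquiv L (IsCMField.complexConj L) 3 (Matrix.diagonal dV) v).symm.toMulEquiv.toMonoidHom.comp
          (cmDatumLocalCongr L v T ha h : Gqs L v ≃ₜ* (cmDatum L 3 (Matrix.diagonal dV)).Local v).toMulEquiv.toMonoidHom)).comp
        (cmBorelTriple L 3 v).N.subtype))
    (σ : Representation ℂ (localPi L (IsCMField.complexConj L) 1 (JW (↥(maximalRealSubfield L)) L ε) v) S₁)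
    (hσ : ∀ (u : localPi L (IsCMField.complexConj L) 1 (JW (↥(maximalRealSubfield L)) L ε) v)
      (f : SchwartzBruhat (Fin n' → v.adicCompletion ↥(maximalRealSubfield L))),
      π ((chiLocalSplittingsCM L e₁ dV hdV hdV0 (toHeckeCharacter L μ) ((isOscillatorChar_toHeckeCharacter_iff μ).mpr hμ) ε).omegaLoc v
        (localCenter L (IsCMField.complexConj L) n' (Matrix.reindex e₁ e₁ (Matrix.diagonal dV ⊗ₖ JW (↥(maximalRealSubfield L)) L ε))
          (JW (↥(maximalRealSubfield L)) L ε) (JW_apply_ne_zero (↥(maximalRealSubfield L)) L ε) v u) f) = σ u (π f))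
    (Tr : S₁ ≃ₗ[ℂ] SchwartzBruhat (Fin n₀ → v.adicCompletion ↥(maximalRealSubfield L)))
    (hTr : ∀ (u : localPi L (IsCMField.complexConj L) 1 (JW (↥(maximalRealSubfield L)) L ε) v) (s : S₁),
      lineWeilCM L e₀ (kernelLineCM dV) (complexConj_kernelLineCM dV hdV) (kernelLineCM_ne_zero dV hdV0) μ hμ ε v u (Tr s) =
        ((((toHeckeCharacter L μ).semilocalComponent L v
          ((localDet (IsCMField.complexConj L) v
            (isUnit_iff_ne_zero.mpr (by rw [Matrix.det_fin_one]; exact JW_apply_ne_zero (↥(maximalRealSubfield L)) L ε))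
            (localPiEquiv L (IsCMField.complexConj L) 1 (JW (↥(maximalRealSubfield L)) L ε) v u) :
              ↥(normOneUnits (conjLocal L (IsCMField.complexConj L) v))) : (UnitaryGroup.LocalRing L v)ˣ))⁻¹ : ℂˣ) : ℂ) • Tr (σ u s)) :
    Nonempty (((cmBorelTriple L 3 v).restrict (xThetaGqsCM L e₁ dV hdV hdV0 μ hμ χf ε v T ha h)).Coinvariants ≃ₗ[ℂ]
      ↥(weightSpace (lineWeilCM L e₀ (kernelLineCM dV) (complexConj_kernelLineCM dV hdV) (kernelLineCM_ne_zero dV hdV0) μ hμ ε v) id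
        (fun u => ((ψθ (localDet (IsCMField.complexConj L) v
          (isUnit_iff_ne_zero.mpr (by rw [Matrix.det_fin_one]; exact JW_apply_ne_zero (↥(maximalRealSubfield L)) L ε))
          (localPiEquiv L (IsCMField.complexConj L) 1 (JW (↥(maximalRealSubfield L)) L ε) v u)) : ℂˣ) : ℂ)))) :=
  nonempty_jacquet_xThetaGqsCM_equiv_weightSpace_of_thetaCenterChar L e₁ dV hdV hdV0 e₀ μ hμ χf ε v hv ψθ hψθ
    ((continuous_of_isThetaCenterChar L μ χf hχf ε v ψθ hψθ).comp
      ((continuous_localDet (IsCMField.complexConj L) v _).comp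
        (localPiEquiv L (IsCMField.complexConj L) 1 (JW (↥(maximalRealSubfield L)) L ε) v).continuous))
    T ha h π hπ hker σ hσ Tr hTr

end Summit.HodgeConjecture.HodgeConjecture.Cruxes.H413.F0P2oThetaTypeJacquetLetterAOfDictionary

end
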